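import Summits.KontsevichZagierPeriods.KontsevichZagierPeriods.Theses.WeightFloor
import Summits.KontsevichZagierPeriods.KontsevichZagierPeriods.Theorems.InverseLandauTateLiftingBeanStoneDisc

/-!
# `BeanStoneDisc` (stmt-KontsevichZagierPeriods-12252, route WeightFloor) — proof

The bean-shaped stone `σ = {4y² ≤ (1 − x²)(2 + x)², −1 ≤ x}` with the integrand `1` and the closed
unit disc `{x² + w² ≤ 1}` with the integrand `1` are equivalent in the Kontsevich–Zagier calculus:
for any representations `r`, `r'` with these domains and integrands `1` on them, `KZ.Equivalent r r'`.
This is verbatim `InverseLandau.tateLifting_beanStoneDisc`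
(Theorems/InverseLandauTateLiftingBeanStoneDisc.lean; stub `stub_beanStoneDisc` of line `Sketch` of the
crux `TateLifting`, lead c10): one change of variables along the shear `(x, w) ↦ (x, w(2 + x)/2)`,
integrand additivity, and the odd part `[D̄, x/2]` killed by the point reflection plus torsion-freeness.
-/

namespace Summit.KontsevichZagierPeriods.WeightFloor

/-- **`BeanStoneDisc`** (route WeightFloor, stmt-KontsevichZagierPeriods-12252): the bean
`{4y² ≤ (1 − x²)(2 + x)², −1 ≤ x}` with integrand `1` is KZ-equivalent to the closed unit disc with
integrand `1`. Proof: `InverseLandau.tateLifting_beanStoneDisc`. [cite: KontsevichZagier2001, §1.2] -/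
theorem beanStoneDisc_proof :
    Summit.KontsevichZagierPeriods.KontsevichZagierPeriods.Theses.WeightFloor.BeanStoneDisc :=
  Summit.KontsevichZagierPeriods.InverseLandau.tateLifting_beanStoneDisc

end Summit.KontsevichZagierPeriods.WeightFloor
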